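import Literature.NumberTheory.Automorphic.UnitaryRegularOrbitalIntegralLocallyConstant   -- ★ (N) `cayleyChartImage_mem_nhds`, `continuous_cayleyUnit`, `isCompact_inter_skew_closedBall`
import Literature.NumberTheory.Automorphic.ConjugationProperOnRegularCompacta              -- ★ (ii′) `UnitaryGroupOfForm.isCompact_image_mk_setOf_exists_conj_mem_of_charpoly_separable`
import Literature.MeasureTheory.Group.QuotientAveraging                                    -- ★ Weil lift `WeilQuotient.exists_isCompact_image_mk_superset`
import HarnessLib

/-!
# Harish-Chandra's uniform compactness at a `G`-NEIGHBOURHOOD of a regular element with compact centraliser (elliptic case)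

Topic `NumberTheory/Automorphic`; namespace `Literature.NumberTheory.Automorphic`. THEOREMS ONLY (no definition, no instance, no notation, no named
fact, no `sorry`). Cell `pub/hodgecm-mathlib`, generic base-layer brick «ELL-READING (UC)-G» (FILE 2 of the generic part of census HC-SC v1 §2 E2-4;
count-neutral, no road implied): it produces the hypothesis (UC) of ★ `CoefficientOrbitalFunctionEllipticReading` («`u(x g x⁻¹) = 0` for `g ∈ C₀`, `x ∉ S`,
ONE compact `S`, `C₀` a neighbourhood of `γ₀` IN `G`») at a regular semisimple `γ₀` whose centraliser is COMPACT.

THE MATHEMATICS [HarishChandra1970, Part V §4, Lemma 23 and the proof of Theorem 12 (pp. 57–62)]. The torus-directional uniform compactness (★ (ii′):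
for a compact `K ⊆ Z(γ)` of regular elements and a compact `C`, `{ẋ ∈ G ⧸ Z(γ) ∣ ∃ t ∈ K, x t x⁻¹ ∈ C}` is compact) is upgraded to a `G`-neighbourhood
`Ω ∋ γ` by the local product structure of the regular set: «the mapping `(x̄, t) ↦ x t x⁻¹` of `Ḡ × Γ′` onto `G_Γ` is locally an analytic homeomorphism»
(proof of Theorem 12), here in the tree's Cayley coordinates (★ `cayleyChartImage_mem_nhds`, clause (N): every `g ∈ Ω` is `c(X) · (γ c(Y)) · c(X)⁻¹` with
`‖X‖ ≤ ½` and `Y` small in `C(γ)`, so `g = y t y⁻¹` with `y` in ONE compact `Y_s = c(‖X‖ ≤ ½)` and `t` in ONE compact `K_T = γ c(‖Y‖ ≤ r′) ⊆ Z(γ)` of regular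
elements). Then `x g x⁻¹ ∈ C` ⇒ `(x y) t (x y)⁻¹ ∈ C` ⇒ `π(x y) ∈ E` (★ (ii′)) ⇒ `x y ∈ L · Z(γ)` for a compact lift `L` of `E` (★ Weil lift; `Z(γ)` COMPACT) ⇒
`x ∈ L · Z(γ) · Y_s⁻¹ =: S`, compact.

* §1 `exists_isCompact_forall_conj_mem_of_conj_chart` — the generic assembly (any topological group, compact `T`, a «conjugation chart» `Ω ⊆ Y·K·Y⁻¹`
  and the (ii′) compactness as hypotheses);
* §2 **`UnitaryGroupOfForm.exists_nhds_isCompact_forall_conj_mem_of_isCompact_centralizer`** — `U(σ, J)(E)`, `E` complete proper non-trivially normed of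
  characteristic zero, `γ` with separable characteristic polynomial and COMPACT centraliser, `C` compact:
  `∃ C₀ ∈ 𝓝 γ, ∃ S compact, ∀ g ∈ C₀, ∀ x, x g x⁻¹ ∈ C → x ∈ S`; and its support form `…_forall_apply_conj_eq_zero…` for a function supported in `C`.
NOT here: the `«local»` ∕ `cmDatum` transport (★ `ConjugationProperOnRegularCompactaLocal` §1 carries it verbatim on a consumer's word), the compactness of
`Z(γ)` at an elliptic regular class of `U(Φ₃)(L⁺_v)` (ELL-TOR cone), the reading itself (★ FILE 1). HONEST LABEL: HC_CM is proved only modulo the printed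
citations until rung 0 closes; this file is topology and pays nothing by itself.

## References
* [HarishChandra1970] Harish-Chandra (notes by G. van Dijk), *Harmonic Analysis on Reductive p-adic Groups*, LNM 162 (1970), Part I §3 Lemma 14; Part V §4
  Lemma 23, Theorem 12 (pp. 57–62).
* [Rogawski1990] J. D. Rogawski, *Automorphic Representations of Unitary Groups in Three Variables*, Ann. of Math. Stud. 123 (1990), §4.9 p. 54; §12.6 p. 187.
* [Weyl1939] H. Weyl, *The Classical Groups* (1939), Ch. II §10 (Cayley parametrisation).
-/

set_option autoImplicit false

noncomputable section

open MeasureTheory Measure Set Filter Topology Polynomial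
open Literature.Analysis.Calculus Literature.LinearAlgebra.Matrix Literature.MeasureTheory.Group
open scoped Matrix.Norms.Operator Matrix MatrixGroups Pointwise

namespace Literature.NumberTheory.Automorphic

/-! ## §1 The generic assembly: conjugation chart + torus uniform compactness + compact torus -/

section Generic

variable {G : Type*} [Group G] [TopologicalSpace G] [IsTopologicalGroup G] [LocallyCompactSpace G]

/-- **`G`-neighbourhood uniform compactness from a conjugation chart.** `T ≤ G` COMPACT; every `g ∈ Ω` is `y t y⁻¹` with `y ∈ Y` (compact) and
`t ∈ K`; (ii′) `{ż ∈ G ⧸ T ∣ ∃ t ∈ K, z t z⁻¹ ∈ C}` compact. Then ONE compact `S = L · T · Y⁻¹` (`L` a compact lift of (ii′), ★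
`WeilQuotient.exists_isCompact_image_mk_superset`) contains every `x` with `x g x⁻¹ ∈ C` for some `g ∈ Ω`.
[cite: HarishChandra1970, Part V §4 Lemma 23 (pp. 57–62)] -/
theorem exists_isCompact_forall_conj_mem_of_conj_chart (T : Subgroup G) (hT : IsCompact (T : Set G)) {Ω Y K C : Set G}
    (hY : IsCompact Y) (hΩ : ∀ g ∈ Ω, ∃ y ∈ Y, ∃ t ∈ K, g = y * t * y⁻¹)
    (hE : IsCompact ((QuotientGroup.mk : G → G ⧸ T) '' {z : G | ∃ t ∈ K, z * t * z⁻¹ ∈ C})) :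
    ∃ S : Set G, IsCompact S ∧ ∀ g ∈ Ω, ∀ x : G, x * g * x⁻¹ ∈ C → x ∈ S := by
  obtain ⟨L, hL, hEL⟩ := WeilQuotient.exists_isCompact_image_mk_superset (H := T) hE
  refine ⟨L * (T : Set G) * Y⁻¹, (hL.mul hT).mul hY.inv, fun g hg x hx => ?_⟩
  obtain ⟨y, hy, t, ht, rfl⟩ := hΩ g hg
  have hxy : x * (y * t * y⁻¹) * x⁻¹ = x * y * t * (x * y)⁻¹ := by group
  rw [hxy] at hx
  obtain ⟨l, hl, hlz⟩ := hEL ⟨x * y, ⟨t, ht, hx⟩, rfl⟩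
  rw [QuotientGroup.eq] at hlz
  refine Set.mem_mul.2 ⟨x * y, Set.mem_mul.2 ⟨l, hl, l⁻¹ * (x * y), hlz, by group⟩, y⁻¹, Set.inv_mem_inv.2 hy, by group⟩

end Generic

/-! ## §2 The unitary groups `U(σ, J)(E)` -/

section Unitary

variable {E : Type*} [NontriviallyNormedField E] [CompleteSpace E] [CharZero E] [ProperSpace E] {m : ℕ}

/-- **HARISH-CHANDRA'S UNIFORM COMPACTNESS AT A `G`-NEIGHBOURHOOD OF A REGULAR ELEMENT WITH COMPACT CENTRALISER, `U(σ, J)(E)` FORM.**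
`E` complete, proper, non-trivially normed, characteristic zero; `σ` a continuous involution; `J` `σ`-hermitian with unit determinant; `γ ∈ U(σ, J)` with
separable characteristic polynomial and COMPACT centraliser `Z(γ)`; `C ⊆ U(σ, J)` compact. Then there are a neighbourhood `C₀` of `γ` in `U(σ, J)` and ONE
compact `S` with: `x g x⁻¹ ∈ C`, `g ∈ C₀` ⇒ `x ∈ S`. (Chart (N) ★ `cayleyChartImage_mem_nhds` with `r = ½` and `B₀` a small ball inside the regular box;
`Y_s = c({‖X‖ ≤ ½} θ-skew ∩ [γ, M])`, `K_T = γ c({‖Y‖ ≤ r′} θ-skew ∩ C(γ)) ⊆ Z(γ)` regular; (ii′) ★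
`UnitaryGroupOfForm.isCompact_image_mk_setOf_exists_conj_mem_of_charpoly_separable`; §1.) [cite: HarishChandra1970, Part V §4 Lemma 23, Thm. 12 (pp. 57–62)]
[cite: Rogawski1990, §4.9 p. 54] [cite: Weyl1939, Ch. II §10] -/
theorem UnitaryGroupOfForm.exists_nhds_isCompact_forall_conj_mem_of_isCompact_centralizer
    [SigmaCompactSpace (GL (Fin m) E)] [LocallyCompactSpace (GL (Fin m) E)]
    {σ : E →+* E} (hσc : Continuous σ) (hσ : ∀ x, σ (σ x) = x) {J : Matrix (Fin m) (Fin m) E}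
    (hJ : (J.map σ)ᵀ = J) (hJu : IsUnit J.det) (γ : ↥(unitaryGroupOfForm σ J))
    (hγ : ((γ : GL (Fin m) E) : Matrix (Fin m) (Fin m) E).charpoly.Separable)
    (hZ : IsCompact (Subgroup.centralizer ({γ} : Set ↥(unitaryGroupOfForm σ J)) : Set ↥(unitaryGroupOfForm σ J)))
    {C : Set ↥(unitaryGroupOfForm σ J)} (hC : IsCompact C) :
    ∃ C₀ ∈ 𝓝 γ, ∃ S : Set ↥(unitaryGroupOfForm σ J), IsCompact S ∧
      ∀ g ∈ C₀, ∀ x : ↥(unitaryGroupOfForm σ J), x * g * x⁻¹ ∈ C → x ∈ S := by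
  haveI : CompleteSpace (Matrix (Fin m) (Fin m) E) := FiniteDimensional.complete E (Matrix (Fin m) (Fin m) E)
  haveI : HasSummableGeomSeries (Matrix (Fin m) (Fin m) E) :=
    @instHasSummableGeomSeriesOfCompleteSpace (Matrix (Fin m) (Fin m) E) _ (FiniteDimensional.complete E (Matrix (Fin m) (Fin m) E))
  haveI : LocallyCompactSpace ↥(unitaryGroupOfForm σ J) := locallyCompactSpace_unitaryGroupOfForm hσc J
  have h1S : ∀ {X : Matrix (Fin m) (Fin m) E}, ‖X‖ < 1 → IsUnit (1 + X) := fun {X} h => by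
    have hu := (Units.oneSub (-X) (by rwa [norm_neg])).isUnit
    rwa [Units.val_oneSub, sub_neg_eq_add] at hu
  have h2S : ∀ {X : Matrix (Fin m) (Fin m) E}, ‖X‖ < 1 → IsUnit (1 - X) := fun {X} h => by
    have hu := (Units.oneSub X h).isUnit
    rwa [Units.val_oneSub] at hu
  -- the small θ-skew sets and the chart datum `s`, `τ` (Cayley units), as in ★ `exists_nhds_classOrbitalIntegral_mk_eq_of_cayleyChart`
  let SA : Set (Matrix (Fin m) (Fin m) E) := {X | X ∈ LinearMap.range (LinearMap.mulLeft E ((γ : GL (Fin m) E) : Matrix (Fin m) (Fin m) E) -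
      LinearMap.mulRight E ((γ : GL (Fin m) E) : Matrix (Fin m) (Fin m) E)) ∧ J⁻¹ * (X.map σ)ᵀ * J = -X ∧ ‖X‖ < 1}
  let SB : Set (Matrix (Fin m) (Fin m) E) := {Y | Y ∈ LinearMap.ker (LinearMap.mulLeft E ((γ : GL (Fin m) E) : Matrix (Fin m) (Fin m) E) -
      LinearMap.mulRight E ((γ : GL (Fin m) E) : Matrix (Fin m) (Fin m) E)) ∧ J⁻¹ * (Y.map σ)ᵀ * J = -Y ∧ ‖Y‖ < 1}
  have hSA1 : ∀ X ∈ SA, ‖X‖ < 1 := fun X hX => hX.2.2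
  have hSB1 : ∀ Y ∈ SB, ‖Y‖ < 1 := fun Y hY => hY.2.2
  have hcU : ∀ {X : Matrix (Fin m) (Fin m) E}, J⁻¹ * (X.map σ)ᵀ * J = -X → (hp : IsUnit (1 + X)) → (hq : IsUnit (1 - X)) →
      (isUnit_cayley hp hq).unit ∈ unitaryGroupOfForm σ J := fun {X} hX hp hq => by
    obtain ⟨g, hg, hgc⟩ := cayley_mem_unitaryGroupOfForm (σ := σ) hJu hX hp hq
    have hge : (isUnit_cayley hp hq).unit = g := Units.ext (by rw [IsUnit.unit_spec, hgc])
    rw [hge]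
    exact hg
  let s : ↥SA → ↥(unitaryGroupOfForm σ J) := fun a =>
    ⟨(isUnit_cayley (h1S (hSA1 a a.2)) (h2S (hSA1 a a.2))).unit,
      hcU a.2.2.1 (h1S (hSA1 a a.2)) (h2S (hSA1 a a.2))⟩
  let cB : ↥SB → ↥(unitaryGroupOfForm σ J) := fun b =>
    ⟨(isUnit_cayley (h1S (hSB1 b b.2)) (h2S (hSB1 b b.2))).unit,
      hcU b.2.2.1 (h1S (hSB1 b b.2)) (h2S (hSB1 b b.2))⟩
  let τ : ↥SB → ↥(unitaryGroupOfForm σ J) := fun b => γ * cB b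
  have hsval : ∀ a : ↥SA, (((s a : ↥(unitaryGroupOfForm σ J)) : GL (Fin m) E) : Matrix (Fin m) (Fin m) E) = cayley (a : Matrix (Fin m) (Fin m) E) :=
    fun a => rfl
  have hτval : ∀ b : ↥SB, (((τ b : ↥(unitaryGroupOfForm σ J)) : GL (Fin m) E) : Matrix (Fin m) (Fin m) E) =
      ((γ : GL (Fin m) E) : Matrix (Fin m) (Fin m) E) * cayley (b : Matrix (Fin m) (Fin m) E) := fun b => rfl
  have hs : Continuous s :=
    (continuous_cayleyUnit (S := SA) (fun a => h1S (hSA1 a a.2)) (fun a => h2S (hSA1 a a.2))).subtype_mk _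
  have hτ : Continuous τ :=
    continuous_const.mul ((continuous_cayleyUnit (S := SB) (fun b => h1S (hSB1 b b.2)) (fun b => h2S (hSB1 b b.2))).subtype_mk _)
  -- the base point `b₀ = 0`, `τ b₀ = γ`
  have hθ0 : J⁻¹ * ((0 : Matrix (Fin m) (Fin m) E).map σ)ᵀ * J = -0 := by
    rw [Matrix.map_zero σ (map_zero σ), Matrix.transpose_zero, Matrix.mul_zero, Matrix.zero_mul, neg_zero]
  let b₀ : ↥SB := ⟨0, LinearMap.mem_ker.2 (map_zero _), hθ0, by rw [norm_zero]; exact one_pos⟩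
  have hτ₀ : τ b₀ = γ := by
    apply Subtype.ext
    apply Units.ext
    rw [hτval b₀, show ((b₀ : ↥SB) : Matrix (Fin m) (Fin m) E) = 0 from rfl, cayley_zero, mul_one]
  -- commuting: `Y ∈ C(γ)` ⇒ `γ c(Y) ∈ Z_U(γ)`
  have hcomm : ∀ b : ↥SB, τ b ∈ Subgroup.centralizer ({γ} : Set ↥(unitaryGroupOfForm σ J)) := fun b => by
    have hk : Commute ((γ : GL (Fin m) E) : Matrix (Fin m) (Fin m) E) (b : Matrix (Fin m) (Fin m) E) := by
      have h := LinearMap.mem_ker.1 b.2.1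
      rw [LinearMap.sub_apply, LinearMap.mulLeft_apply, LinearMap.mulRight_apply, sub_eq_zero] at h
      exact h
    have hc := commute_cayley hk (h1S (hSB1 b b.2))
    rw [Subgroup.mem_centralizer_singleton_iff]
    apply Subtype.ext
    apply Units.ext
    show (((τ b : ↥(unitaryGroupOfForm σ J)) : GL (Fin m) E) : Matrix (Fin m) (Fin m) E) * ((γ : GL (Fin m) E) : Matrix (Fin m) (Fin m) E) =
      ((γ : GL (Fin m) E) : Matrix (Fin m) (Fin m) E) * (((τ b : ↥(unitaryGroupOfForm σ J)) : GL (Fin m) E) : Matrix (Fin m) (Fin m) E)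
    rw [hτval, mul_assoc, ← hc.eq]
  -- the regular box `O₂ ∋ 0`
  have hregO : IsOpen {u : ↥(unitaryGroupOfForm σ J) | ((u : GL (Fin m) E) : Matrix (Fin m) (Fin m) E).charpoly.Separable} :=
    (unitaryGroupOfForm σ J).isOpen_setOf_charpoly_separable
  have hW₂ : τ ⁻¹' {u : ↥(unitaryGroupOfForm σ J) | ((u : GL (Fin m) E) : Matrix (Fin m) (Fin m) E).charpoly.Separable} ∈ 𝓝 b₀ := by
    refine hτ.continuousAt.preimage_mem_nhds (hregO.mem_nhds ?_)
    show (((τ b₀ : ↥(unitaryGroupOfForm σ J)) : GL (Fin m) E) : Matrix (Fin m) (Fin m) E).charpoly.Separable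
    rw [hτ₀]
    exact hγ
  obtain ⟨V₂, hV₂, hV₂W⟩ := (mem_nhds_subtype SB b₀ _).1 hW₂
  obtain ⟨ρ, hρ, hρV⟩ := Metric.mem_nhds_iff.1 hV₂
  -- the radius `r′ = min (ρ/2) (1/2)` and the ball `B₀ = ball 0 r′`
  set r' : ℝ := min (ρ / 2) (1 / 2) with hr'
  have hr'pos : 0 < r' := lt_min (half_pos hρ) one_half_pos
  have hr'ρ : r' < ρ := lt_of_le_of_lt (min_le_left _ _) (half_lt_self hρ)
  have hr'1 : r' < 1 := lt_of_le_of_lt (min_le_right _ _) (by norm_num)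
  -- (N): the chart image `Ω` is a neighbourhood of `γ`
  have hΩ := cayleyChartImage_mem_nhds σ hσc hJu γ hγ one_half_pos (Metric.isOpen_ball (x := (0 : Matrix (Fin m) (Fin m) E)) (ε := r'))
    (Metric.mem_ball_self hr'pos)
  -- the compact pieces `Y_s = s(‖X‖ ≤ ½)` and `K_T = τ(‖Y‖ ≤ r′)`
  have hKA : IsCompact {a : ↥SA | ‖(a : Matrix (Fin m) (Fin m) E)‖ ≤ 1 / 2} := by
    rw [Topology.IsEmbedding.subtypeVal.isCompact_iff]
    have himg : Subtype.val '' {a : ↥SA | ‖(a : Matrix (Fin m) (Fin m) E)‖ ≤ 1 / 2} =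
        {X : Matrix (Fin m) (Fin m) E | X ∈ LinearMap.range (LinearMap.mulLeft E ((γ : GL (Fin m) E) : Matrix (Fin m) (Fin m) E) -
          LinearMap.mulRight E ((γ : GL (Fin m) E) : Matrix (Fin m) (Fin m) E)) ∧ J⁻¹ * (X.map σ)ᵀ * J = -X} ∩ Metric.closedBall 0 (1 / 2) := by
      ext X
      constructor
      · rintro ⟨a, ha, rfl⟩
        exact ⟨⟨a.2.1, a.2.2.1⟩, by rw [Metric.mem_closedBall, dist_zero_right]; exact ha⟩
      · rintro ⟨⟨h1, h2⟩, h3⟩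
        rw [Metric.mem_closedBall, dist_zero_right] at h3
        exact ⟨⟨X, h1, h2, lt_of_le_of_lt h3 (by norm_num)⟩, h3, rfl⟩
    rw [himg]
    exact isCompact_inter_skew_closedBall σ hσc J _ _
  have hKB : IsCompact {b : ↥SB | ‖(b : Matrix (Fin m) (Fin m) E)‖ ≤ r'} := by
    rw [Topology.IsEmbedding.subtypeVal.isCompact_iff]
    have himg : Subtype.val '' {b : ↥SB | ‖(b : Matrix (Fin m) (Fin m) E)‖ ≤ r'} =
        {Y : Matrix (Fin m) (Fin m) E | Y ∈ LinearMap.ker (LinearMap.mulLeft E ((γ : GL (Fin m) E) : Matrix (Fin m) (Fin m) E) -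
          LinearMap.mulRight E ((γ : GL (Fin m) E) : Matrix (Fin m) (Fin m) E)) ∧ J⁻¹ * (Y.map σ)ᵀ * J = -Y} ∩ Metric.closedBall 0 r' := by
      ext Y
      constructor
      · rintro ⟨b, hb, rfl⟩
        exact ⟨⟨b.2.1, b.2.2.1⟩, by rw [Metric.mem_closedBall, dist_zero_right]; exact hb⟩
      · rintro ⟨⟨h1, h2⟩, h3⟩
        rw [Metric.mem_closedBall, dist_zero_right] at h3
        exact ⟨⟨Y, h1, h2, lt_of_le_of_lt h3 hr'1⟩, h3, rfl⟩
    rw [himg]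
    exact isCompact_inter_skew_closedBall σ hσc J _ _
  have hYs : IsCompact (s '' {a : ↥SA | ‖(a : Matrix (Fin m) (Fin m) E)‖ ≤ 1 / 2}) := hKA.image hs
  have hKT : IsCompact (τ '' {b : ↥SB | ‖(b : Matrix (Fin m) (Fin m) E)‖ ≤ r'}) := hKB.image hτ
  have hKTZ : τ '' {b : ↥SB | ‖(b : Matrix (Fin m) (Fin m) E)‖ ≤ r'} ⊆ Subgroup.centralizer ({γ} : Set ↥(unitaryGroupOfForm σ J)) := by
    rintro _ ⟨b, -, rfl⟩
    exact hcomm b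
  have hKTreg : ∀ t ∈ τ '' {b : ↥SB | ‖(b : Matrix (Fin m) (Fin m) E)‖ ≤ r'},
      ((t : GL (Fin m) E) : Matrix (Fin m) (Fin m) E).charpoly.Separable := by
    rintro _ ⟨b, hb, rfl⟩
    have hbρ : (b : Matrix (Fin m) (Fin m) E) ∈ Metric.ball (0 : Matrix (Fin m) (Fin m) E) ρ := by
      rw [Metric.mem_ball, dist_zero_right]
      exact lt_of_le_of_lt hb hr'ρ
    exact hV₂W (hρV hbρ)
  -- (ii′) at the compact torus piece `K_T`
  have hE := UnitaryGroupOfForm.isCompact_image_mk_setOf_exists_conj_mem_of_charpoly_separable (m := m) two_ne_zero hσc hσ hJ hJu γ hγ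
    hKT hKTZ hKTreg hC
  -- every `g ∈ Ω` is `s(a) τ(b) s(a)⁻¹`
  have hconjval : ∀ x t : GL (Fin m) E, (((x * t * x⁻¹ : GL (Fin m) E)) : Matrix (Fin m) (Fin m) E) =
      (x : Matrix (Fin m) (Fin m) E) * (t : Matrix (Fin m) (Fin m) E) * Ring.inverse (x : Matrix (Fin m) (Fin m) E) := fun x t => by
    rw [Units.val_mul, Units.val_mul, Ring.inverse_unit]
  have hchart : ∀ g ∈ {u : ↥(unitaryGroupOfForm σ J) | ∃ X Y : Matrix (Fin m) (Fin m) E,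
        X ∈ LinearMap.range (LinearMap.mulLeft E ((γ : GL (Fin m) E) : Matrix (Fin m) (Fin m) E) -
          LinearMap.mulRight E ((γ : GL (Fin m) E) : Matrix (Fin m) (Fin m) E)) ∧
        J⁻¹ * (X.map σ)ᵀ * J = -X ∧ ‖X‖ ≤ 1 / 2 ∧
        Y ∈ LinearMap.ker (LinearMap.mulLeft E ((γ : GL (Fin m) E) : Matrix (Fin m) (Fin m) E) -
          LinearMap.mulRight E ((γ : GL (Fin m) E) : Matrix (Fin m) (Fin m) E)) ∧
        J⁻¹ * (Y.map σ)ᵀ * J = -Y ∧ Y ∈ Metric.ball (0 : Matrix (Fin m) (Fin m) E) r' ∧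
        ((u : GL (Fin m) E) : Matrix (Fin m) (Fin m) E) =
          cayley X * (((γ : GL (Fin m) E) : Matrix (Fin m) (Fin m) E) * cayley Y) * Ring.inverse (cayley X)},
      ∃ y ∈ s '' {a : ↥SA | ‖(a : Matrix (Fin m) (Fin m) E)‖ ≤ 1 / 2}, ∃ t ∈ τ '' {b : ↥SB | ‖(b : Matrix (Fin m) (Fin m) E)‖ ≤ r'},
        g = y * t * y⁻¹ := by
    rintro g ⟨X, Y, hXr, hXθ, hXn, hYk, hYθ, hYB, hgXY⟩
    have hY1 : ‖Y‖ ≤ r' := by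
      rw [Metric.mem_ball, dist_zero_right] at hYB
      exact le_of_lt hYB
    have hX1 : ‖X‖ < 1 := lt_of_le_of_lt hXn (by norm_num)
    let a : ↥SA := ⟨X, hXr, hXθ, hX1⟩
    let b : ↥SB := ⟨Y, hYk, hYθ, lt_of_le_of_lt hY1 hr'1⟩
    have ha : a ∈ {a : ↥SA | ‖(a : Matrix (Fin m) (Fin m) E)‖ ≤ 1 / 2} := hXn
    have hb : b ∈ {b : ↥SB | ‖(b : Matrix (Fin m) (Fin m) E)‖ ≤ r'} := hY1
    refine ⟨s a, Set.mem_image_of_mem s ha, τ b, Set.mem_image_of_mem τ hb, ?_⟩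
    apply Subtype.ext
    apply Units.ext
    show ((g : GL (Fin m) E) : Matrix (Fin m) (Fin m) E) =
      (((s a : GL (Fin m) E) * (τ b : GL (Fin m) E) * (s a : GL (Fin m) E)⁻¹ : GL (Fin m) E) : Matrix (Fin m) (Fin m) E)
    rw [hconjval, hgXY]
    rfl
  -- §1
  obtain ⟨S, hS, hSconj⟩ := exists_isCompact_forall_conj_mem_of_conj_chart (Subgroup.centralizer ({γ} : Set ↥(unitaryGroupOfForm σ J))) hZ
    hYs hchart hE
  exact ⟨_, hΩ, S, hS, hSconj⟩

/-- The SUPPORT form of ★ `UnitaryGroupOfForm.exists_nhds_isCompact_forall_conj_mem_of_isCompact_centralizer` — exactly the hypothesis (UC) of ★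
`CoefficientOrbitalFunctionEllipticReading.eq_mul_integral_conj_of_forall_setIntegral_eq`: for `u : U(σ, J) → Y` supported in a compact `C` there are an OPEN
`C₀ ∋ γ` and a compact `S` with `u(x g x⁻¹) = 0` for `g ∈ C₀`, `x ∉ S`. [cite: HarishChandra1970, Part V §4 Lemma 23 (pp. 57–62)] [cite: Rogawski1990, §12.6 p. 187] -/
theorem UnitaryGroupOfForm.exists_isOpen_isCompact_forall_apply_conj_eq_zero_of_isCompact_centralizer
    [SigmaCompactSpace (GL (Fin m) E)] [LocallyCompactSpace (GL (Fin m) E)]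
    {σ : E →+* E} (hσc : Continuous σ) (hσ : ∀ x, σ (σ x) = x) {J : Matrix (Fin m) (Fin m) E}
    (hJ : (J.map σ)ᵀ = J) (hJu : IsUnit J.det) (γ : ↥(unitaryGroupOfForm σ J))
    (hγ : ((γ : GL (Fin m) E) : Matrix (Fin m) (Fin m) E).charpoly.Separable)
    (hZ : IsCompact (Subgroup.centralizer ({γ} : Set ↥(unitaryGroupOfForm σ J)) : Set ↥(unitaryGroupOfForm σ J)))
    {Y : Type*} [Zero Y] {u : ↥(unitaryGroupOfForm σ J) → Y} {C : Set ↥(unitaryGroupOfForm σ J)} (hC : IsCompact C)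
    (huC : Function.support u ⊆ C) :
    ∃ C₀ : Set ↥(unitaryGroupOfForm σ J), IsOpen C₀ ∧ γ ∈ C₀ ∧ ∃ S : Set ↥(unitaryGroupOfForm σ J), IsCompact S ∧
      ∀ g ∈ C₀, ∀ x : ↥(unitaryGroupOfForm σ J), x ∉ S → u (x * g * x⁻¹) = 0 := by
  obtain ⟨C₁, hC₁, S, hS, hconj⟩ :=
    UnitaryGroupOfForm.exists_nhds_isCompact_forall_conj_mem_of_isCompact_centralizer hσc hσ hJ hJu γ hγ hZ hC
  obtain ⟨C₀, hC₀C₁, hC₀o, hγC₀⟩ := _root_.mem_nhds_iff.1 hC₁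
  refine ⟨C₀, hC₀o, hγC₀, S, hS, fun g hg x hx => ?_⟩
  by_contra h
  exact hx (hconj g (hC₀C₁ hg) x (huC h))

end Unitary

end Literature.NumberTheory.Automorphic

end
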